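import Literature.NumberTheory.Automorphic.ArchKFiniteGardingVector
import Literature.NumberTheory.Automorphic.ArchWhittakerBiDistribution
import HarnessLib

/-!
# Density of the `K_∞`-finite Gårding vectors; a continuous Whittaker functional does not vanish on them
# (Harish-Chandra (1953); Knapp (1986), Ch. VIII §2; Jacquet–Langlands (1970), §5)

Topic `NumberTheory/Automorphic`; namespace `Literature.NumberTheory.Automorphic`. Theorems only (no
definition, no named fact, no instance). Let `τ` be a strongly continuous unitary representation of
`G_∞ = GL_n(K_∞)` on a Hilbert space `E`, `𝒢` its Gårding space (`ArchGardingWhittaker`). A vector `e` is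
`K_∞`-FINITE if the `K_∞`-translates of `e` span a finite-dimensional space (as in
`ArchKFiniteGardingVector.exists_kFinite_mem_archGardingSpace_ne_zero`).

* `exists_adInvariant_isDiracSeq` — an `Ad K_∞`-invariant Dirac sequence in `C_c^∞(G_∞)` (the bumps of
  `exists_adInvariant_isArchTestFunction`, normalised, along a countable neighbourhood basis of `1`).
* `exists_kFinite_mem_archGardingSpace_ne_zero_of_mem` — Harish-Chandra's construction of a non-zero
  `K_∞`-finite Gårding vector INSIDE a closed subspace `M` stable under `K_∞` and under the smoothing
  operators `τ(α)` of the `Ad K_∞`-invariant real test functions (the proof of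
  `exists_kFinite_mem_archGardingSpace_ne_zero`, run in `M`).
* `eq_zero_of_forall_inner_kFinite_eq_zero` — **density of the `K_∞`-finite Gårding vectors** (Harish-Chandra;
  Knapp (1986), Ch. VIII §2): a vector orthogonal to all of them is `0` (apply the previous construction in
  the orthogonal complement of their span, which is closed, `K_∞`-stable by unitarity and `τ(α)`-stable by
  `⟪τ(α) x, e⟫ = ⟪x, τ(α^*) e⟫`).
* `exists_kFinite_apply_ne_zero` — **a non-zero continuous `ψ_∞`-Whittaker functional `ℓ` does not vanish
  on the `K_∞`-finite Gårding vectors** (the archimedean starting point of Jacquet–Langlands (1970), §5,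
  Thm. 5.13 ff.: the Whittaker/Kirillov model is read on `K_∞`-finite vectors): otherwise every Riesz vector
  `ξ_α` (`ArchWhittakerRieszVectors`: `⟪ξ_α, e⟫ = ℓ(τ(α) e)`) of an `Ad K_∞`-invariant `α` is orthogonal to the
  `K_∞`-finite vectors, hence `0`, so `ℓ(τ(α) v) = 0` for all `v`; along an `Ad K_∞`-invariant Dirac sequence
  `ℓ(τ(β_m) τ(ψ) e) → ℓ(τ(ψ) e)` (`tendsto_apply_archSmoothing_archSmoothing`), so `ℓ = 0` on the generators
  of `𝒢`.

## References

* Harish-Chandra, *Representations of a semisimple Lie group on a Banach space. I*, Trans. AMS 75 (1953), §9.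
* A. W. Knapp, *Representation Theory of Semisimple Groups*, Princeton 1986, Ch. VIII §2. [Knapp1986]
* H. Jacquet, R. P. Langlands, *Automorphic Forms on GL(2)*, LNM 114 (1970), §5. [JacquetLanglands1970]
* A. Borel, *Représentations de groupes localement compacts*, LNM 276 (1972), 3.4. [Borel1972]
-/

noncomputable section

open MeasureTheory Measure NumberField NumberField.InfinitePlace NumberField.mixedEmbedding IsDedekindDomain Set Filter
open scoped MatrixGroups Topology Classical ContDiff InnerProductSpace ComplexConjugate

namespace Literature.NumberTheory.Automorphic

variable {n : ℕ} {K : Type} [Field K] [NumberField K]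

-- as in `ArchGardingWhittaker`
set_option backward.isDefEq.respectTransparency false

attribute [local instance] glInfBorel borelSpace_glInf locallyCompactSpace_glInf secondCountableTopology_glInf

/-! ### 1. `Ad K_∞`-invariant Dirac sequences -/

section Dirac

/-- **`Ad K_∞`-invariant Dirac sequences exist**: non-negative real test functions `β_m` of integral `1`,
`β_m(k x k⁻¹) = β_m(x)` for `k ∈ K_∞`, `β_m(x⁻¹) = β_m(x)`, with supports shrinking to `1`.
[cite: Borel1972, 3.4] -/
theorem exists_adInvariant_isDiracSeq :
    ∃ β : ℕ → GL (Fin n) (mixedSpace K) → ℝ, IsDiracSeq (n := n) (K := K) β ∧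
      (∀ m, ∀ k ∈ Kinf n K, ∀ x, β m (k * x * k⁻¹) = β m x) ∧ ∀ m x, β m x⁻¹ = β m x := by
  obtain ⟨U, hU⟩ := (𝓝 (1 : GL (Fin n) (mixedSpace K))).exists_antitone_basis
  have hαex : ∀ m : ℕ, ∃ α : GL (Fin n) (mixedSpace K) → ℝ, IsArchTestFunction n K (fun x => (α x : ℂ)) ∧
      (∀ x, 0 ≤ α x) ∧ α 1 = 1 ∧ (∀ x, α x⁻¹ = α x) ∧ (∀ k ∈ Kinf n K, ∀ x, α (k * x * k⁻¹) = α x) ∧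
      ∀ x, α x ≠ 0 → x ∈ U m := fun m => exists_adInvariant_isArchTestFunction (hU.mem m)
  choose α hαt hα0 hα1 hαi hαk hαU using hαex
  have hαc : ∀ m, Continuous (α m) := fun m => by
    have h := Complex.continuous_re.comp (hαt m).continuous
    have e : (Complex.re ∘ fun x => (α m x : ℂ)) = α m := by funext x; simp
    rwa [e] at h
  have hαs : ∀ m, HasCompactSupport (α m) := fun m => by
    have h := (hαt m).hasCompactSupport.comp_left (g := Complex.re) Complex.zero_re
    have e : (Complex.re ∘ fun x => (α m x : ℂ)) = α m := by funext x; simp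
    rwa [e] at h
  set c : ℕ → ℝ := fun m => ∫ x, α m x ∂(archHaar n K) with hc
  have hcpos : ∀ m, 0 < c m := fun m =>
    (hαc m).integral_pos_of_hasCompactSupport_nonneg_nonzero (hαs m) (hα0 m) (by rw [hα1 m]; exact one_ne_zero)
  refine ⟨fun m x => α m x / c m, ⟨fun m => ?_, fun m => (hαc m).div_const _, fun m => ?_, fun m x =>
    div_nonneg (hα0 m x) (hcpos m).le, fun m => ?_, fun V hV => ?_⟩, fun m k hk x => by
      change α m (k * x * k⁻¹) / c m = α m x / c m; rw [hαk m k hk x],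
    fun m x => by change α m x⁻¹ / c m = α m x / c m; rw [hαi m x]⟩
  · have e : (fun x => ((α m x / c m : ℝ) : ℂ)) = ((c m : ℂ))⁻¹ • fun x => (α m x : ℂ) := by
      funext x
      simp only [Pi.smul_apply, smul_eq_mul, Complex.ofReal_div]
      rw [div_eq_inv_mul]
    rw [e]
    exact (hαt m).smul _
  · exact (hαs m).comp_left (g := fun t : ℝ => t / c m) (zero_div _)
  · rw [integral_div, div_self (hcpos m).ne']
  · have hev : ∀ᶠ m in atTop, U m ⊆ V := by
      obtain ⟨m₀, hm₀⟩ := (hU.1.mem_iff' V).1 hV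
      exact eventually_atTop.2 ⟨m₀, fun m hm => (hU.antitone hm).trans hm₀.2⟩
    filter_upwards [hev] with m hm x hx
    refine hm (hαU m x fun h => ?_)
    exact (Function.mem_support.1 hx) (by rw [h, zero_div])

end Dirac

/-! ### 2. Harish-Chandra's construction inside a stable closed subspace -/

section Construction

variable {hcpt : isCompact_glFiniteIntegralLevel n K}
  {E : Type*} [NormedAddCommGroup E] [InnerProductSpace ℂ E] [CompleteSpace E]
  {τ : ContRepresentation ℂ (AutomorphyDatum.gl n K hcpt).arch.carrier E}

/-- **A non-zero `K_∞`-finite Gårding vector inside a closed subspace `M` stable under `K_∞` and under the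
`τ(α)`, `α` an `Ad K_∞`-invariant real test function**, through any non-zero `v ∈ M`
(the construction of `exists_kFinite_mem_archGardingSpace_ne_zero` run inside `M`: the smear over `K_∞` stays in
`M` by `smear_mem_of_isClosed`, the smoothing by hypothesis). [cite: Knapp1986, Ch. VIII §2] -/
theorem exists_kFinite_mem_archGardingSpace_ne_zero_of_mem (hτ : τ.IsStronglyContinuous)
    {M : Submodule ℂ E} (hMc : IsClosed (M : Set E))
    (hMK : ∀ k ∈ Kinf n K, ∀ x ∈ M, τ (toArch hcpt k) x ∈ M)
    (hMα : ∀ α : GL (Fin n) (mixedSpace K) → ℝ, IsArchTestFunction n K (fun y => (α y : ℂ)) →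
      (∀ k ∈ Kinf n K, ∀ x, α (k * x * k⁻¹) = α x) → ∀ x ∈ M, archSmoothing hcpt τ (fun y => (α y : ℂ)) x ∈ M)
    {v : E} (hv : v ≠ 0) (hvM : v ∈ M) :
    ∃ e ∈ archGardingSpace hcpt τ, e ≠ 0 ∧ e ∈ M ∧
      FiniteDimensional ℂ (Submodule.span ℂ (Set.range fun κ : (AutomorphyDatum.gl n K hcpt).arch.maximalCompact =>
        τ (toArch hcpt (κ : GL (Fin n) (mixedSpace K))) e)) := by
  -- the compact group `K_∞` and the restriction of `τ` to it
  haveI : CompactSpace (Kinf n K) := isCompact_iff_compactSpace.mp (isCompact_Kinf_holds n K)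
  letI : MeasurableSpace (Kinf n K) := borel _
  haveI : BorelSpace (Kinf n K) := ⟨rfl⟩
  let ιK : Kinf n K →* (AutomorphyDatum.gl n K hcpt).arch.carrier :=
    { toFun := fun k => toArch hcpt (k : GL (Fin n) (mixedSpace K))
      map_one' := rfl
      map_mul' := fun _ _ => rfl }
  let τK : ContRepresentation ℂ (Kinf n K) E := τ.restrict ιK
  have hτK : τK.IsStronglyContinuous := fun x =>
    (continuous_apply_toArch hcpt τ hτ x).comp continuous_subtype_val
  -- a non-zero `K_∞`-finite vector `u ∈ M`
  obtain ⟨ψ, -, hne, hfin⟩ := exists_isTranslationFinite_smear_ne_zero (π := τK) (μ := Measure.haar) hτK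
    (separatesPoints_translationFiniteSubalgebra (Kinf n K)) hv
  set u : E := smear τK Measure.haar ψ v with hu
  have huM : u ∈ M := smear_mem_of_isClosed (π := τK) (μ := Measure.haar) hτK hMc (fun k w hw => hMK k k.2 w hw) ψ hvM
  -- an `Ad K_∞`-invariant Dirac bump at scale `‖u‖`
  have hupos : 0 < ‖u‖ := norm_pos_iff.2 hne
  set N : Set (GL (Fin n) (mixedSpace K)) := {h | ‖τ (toArch hcpt h) u - u‖ < ‖u‖ / 2} with hN
  have hNo : IsOpen N := by
    have : N = (fun h : GL (Fin n) (mixedSpace K) => τ (toArch hcpt h) u - u) ⁻¹' Metric.ball 0 (‖u‖ / 2) := by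
      ext h; simp [hN]
    rw [this]
    exact ((continuous_apply_toArch hcpt τ hτ u).sub continuous_const).isOpen_preimage _ Metric.isOpen_ball
  have h1N : (1 : GL (Fin n) (mixedSpace K)) ∈ N := by
    change ‖τ (toArch hcpt 1) u - u‖ < ‖u‖ / 2
    have : τ (toArch hcpt (1 : GL (Fin n) (mixedSpace K))) u = u := by
      change τ 1 u = u; rw [map_one]; rfl
    rw [this, sub_self, norm_zero]
    exact half_pos hupos
  obtain ⟨α, hαt, hα0, hα1, -, hαk, hαN⟩ := exists_adInvariant_isArchTestFunction (hNo.mem_nhds h1N)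
  have hαc : Continuous α := by
    have h := Complex.continuous_re.comp hαt.continuous
    have e : (Complex.re ∘ fun x => (α x : ℂ)) = α := by funext x; simp
    rwa [e] at h
  have hαs : HasCompactSupport α := by
    have h := hαt.hasCompactSupport.comp_left (g := Complex.re) Complex.zero_re
    have e : (Complex.re ∘ fun x => (α x : ℂ)) = α := by funext x; simp
    rwa [e] at h
  -- the vector
  set e : E := archSmoothing hcpt τ (fun x => (α x : ℂ)) u with he
  obtain ⟨hm, hlt⟩ := norm_inv_smul_archSmoothing_sub_lt (hcpt := hcpt) (τ := τ) hτ u hupos hαc hαs hα0 hα1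
    (fun h hh => hαN h hh)
  have he0 : e ≠ 0 := by
    intro h0
    rw [← he, h0, smul_zero, zero_sub, norm_neg] at hlt
    exact lt_irrefl _ hlt
  refine ⟨e, archSmoothing_mem_archGardingSpace hαt u, he0, hMα α hαt hαk u huM, ?_⟩
  have hαk' : ∀ k ∈ Kinf n K, ∀ x, (α (k * x * k⁻¹) : ℂ) = α x := fun k hk x => by rw [hαk k hk x]
  exact finiteDimensional_span_archSmoothing_of_adInvariant hτ hαt.continuous hαt.hasCompactSupport hαk' hfin

end Construction

/-! ### 3. Density of the `K_∞`-finite Gårding vectors -/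

section Density

variable {hcpt : isCompact_glFiniteIntegralLevel n K}
  {E : Type*} [NormedAddCommGroup E] [InnerProductSpace ℂ E] [CompleteSpace E]
  {τ : ContRepresentation ℂ (AutomorphyDatum.gl n K hcpt).arch.carrier E}

omit [CompleteSpace E] in
/-- `K_∞`-translates of `K_∞`-finite vectors are `K_∞`-finite. [folklore] -/
theorem kFinite_apply_toArch {k : GL (Fin n) (mixedSpace K)} (hk : k ∈ Kinf n K) {e : E}
    (hfin : FiniteDimensional ℂ (Submodule.span ℂ (Set.range fun κ : (AutomorphyDatum.gl n K hcpt).arch.maximalCompact =>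
      τ (toArch hcpt (κ : GL (Fin n) (mixedSpace K))) e))) :
    FiniteDimensional ℂ (Submodule.span ℂ (Set.range fun κ : (AutomorphyDatum.gl n K hcpt).arch.maximalCompact =>
      τ (toArch hcpt (κ : GL (Fin n) (mixedSpace K))) (τ (toArch hcpt k) e))) := by
  haveI := hfin
  refine Submodule.finiteDimensional_of_le (S₂ := Submodule.span ℂ (Set.range fun κ : (AutomorphyDatum.gl n K hcpt).arch.maximalCompact =>
      τ (toArch hcpt (κ : GL (Fin n) (mixedSpace K))) e)) (Submodule.span_le.2 ?_)
  rintro _ ⟨κ, rfl⟩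
  refine Submodule.subset_span ⟨⟨κ * k, mul_mem κ.2 hk⟩, ?_⟩
  change τ (toArch hcpt ((κ : GL (Fin n) (mixedSpace K)) * k)) e = _
  have : toArch hcpt ((κ : GL (Fin n) (mixedSpace K)) * k) = toArch hcpt (κ : GL (Fin n) (mixedSpace K)) * toArch hcpt k := rfl
  rw [this, map_mul]
  rfl

/-- **The `K_∞`-finite Gårding vectors of a strongly continuous unitary representation of `GL_n(K_∞)` are
dense**: a vector orthogonal to all of them vanishes (Harish-Chandra (1953); Knapp (1986), Ch. VIII §2).
[cite: Knapp1986, Ch. VIII §2] -/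
theorem eq_zero_of_forall_inner_kFinite_eq_zero (hτ : τ.IsStronglyContinuous) (hτu : τ.IsUnitary) {z : E}
    (hz : ∀ e ∈ archGardingSpace hcpt τ,
      FiniteDimensional ℂ (Submodule.span ℂ (Set.range fun κ : (AutomorphyDatum.gl n K hcpt).arch.maximalCompact =>
        τ (toArch hcpt (κ : GL (Fin n) (mixedSpace K))) e)) → ⟪z, e⟫_ℂ = 0) :
    z = 0 := by
  -- the span `D` of the `K_∞`-finite Gårding vectors and its (closed) orthogonal complement
  set D : Submodule ℂ E := Submodule.span ℂ {e : E | e ∈ archGardingSpace hcpt τ ∧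
    FiniteDimensional ℂ (Submodule.span ℂ (Set.range fun κ : (AutomorphyDatum.gl n K hcpt).arch.maximalCompact =>
      τ (toArch hcpt (κ : GL (Fin n) (mixedSpace K))) e))} with hD
  have hzD : z ∈ Dᗮ := by
    rw [Submodule.mem_orthogonal]
    intro u hu
    refine Submodule.span_induction (p := fun u _ => ⟪u, z⟫_ℂ = 0) ?_ ?_ ?_ ?_ hu
    · rintro e ⟨he, hfin⟩
      rw [inner_eq_zero_symm]; exact hz e he hfin
    · exact inner_zero_left _
    · intro x y _ _ hx hy; rw [inner_add_left, hx, hy, add_zero]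
    · intro c x _ hx; rw [inner_smul_left, hx, mul_zero]
  -- `D` is stable under `K_∞` and under the `τ(α)`, `α` `Ad K_∞`-invariant real test functions
  have hDK : ∀ k ∈ Kinf n K, ∀ x ∈ D, τ (toArch hcpt k) x ∈ D := by
    intro k hk x hx
    refine Submodule.span_induction (p := fun x _ => τ (toArch hcpt k) x ∈ D) ?_ ?_ ?_ ?_ hx
    · rintro e ⟨he, hfin⟩
      exact Submodule.subset_span ⟨apply_mem_archGardingSpace hτ _ he, kFinite_apply_toArch hk hfin⟩
    · rw [map_zero]; exact Submodule.zero_mem _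
    · intro x y _ _ hx hy; rw [map_add]; exact Submodule.add_mem _ hx hy
    · intro c x _ hx; rw [map_smul]; exact Submodule.smul_mem _ c hx
  have hDα : ∀ α : GL (Fin n) (mixedSpace K) → ℝ, IsArchTestFunction n K (fun y => (α y : ℂ)) →
      (∀ k ∈ Kinf n K, ∀ x, α (k * x * k⁻¹) = α x) → ∀ x ∈ D, archSmoothing hcpt τ (fun y => (α y : ℂ)) x ∈ D := by
    intro α hαt hαk x hx
    have hαk' : ∀ k ∈ Kinf n K, ∀ y, (α (k * y * k⁻¹) : ℂ) = α y := fun k hk y => by rw [hαk k hk y]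
    refine Submodule.span_induction (p := fun x _ => archSmoothing hcpt τ (fun y => (α y : ℂ)) x ∈ D) ?_ ?_ ?_ ?_ hx
    · rintro e ⟨-, hfin⟩
      exact Submodule.subset_span ⟨archSmoothing_mem_archGardingSpace hαt e,
        finiteDimensional_span_archSmoothing_of_adInvariant hτ hαt.continuous hαt.hasCompactSupport hαk' hfin⟩
    · have h := archSmoothing_smul_vec hcpt τ (fun y => (α y : ℂ)) 0 (0 : E)
      rw [zero_smul, zero_smul] at h
      rw [h]; exact Submodule.zero_mem _
    · intro x y _ _ hx hy
      rw [archSmoothing_add_vec hcpt τ hαt.continuous hαt.hasCompactSupport hτ]; exact Submodule.add_mem _ hx hy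
    · intro c x _ hx; rw [archSmoothing_smul_vec]; exact Submodule.smul_mem _ c hx
  -- hence so is `Dᗮ`
  have hMK : ∀ k ∈ Kinf n K, ∀ x ∈ Dᗮ, τ (toArch hcpt k) x ∈ Dᗮ := by
    intro k hk x hx
    rw [Submodule.mem_orthogonal] at hx ⊢
    intro u hu
    have h1 : ⟪u, τ (toArch hcpt k) x⟫_ℂ = ⟪τ (toArch hcpt k⁻¹) u, x⟫_ℂ := by
      rw [← hτu.inner_map_map (toArch hcpt k⁻¹) u (τ (toArch hcpt k) x), ← ContinuousLinearMap.comp_apply]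
      have e : (τ (toArch hcpt k⁻¹)).comp (τ (toArch hcpt k)) = 1 := by
        rw [← ContinuousLinearMap.mul_def, ← map_mul]
        change τ (toArch hcpt (k⁻¹ * k)) = 1
        rw [inv_mul_cancel]; exact map_one τ
      rw [e, one_apply_eq_self]
    rw [h1]
    exact hx _ (hDK _ (inv_mem hk) u hu)
  have hMα : ∀ α : GL (Fin n) (mixedSpace K) → ℝ, IsArchTestFunction n K (fun y => (α y : ℂ)) →
      (∀ k ∈ Kinf n K, ∀ x, α (k * x * k⁻¹) = α x) → ∀ x ∈ Dᗮ, archSmoothing hcpt τ (fun y => (α y : ℂ)) x ∈ Dᗮ := by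
    intro α hαt hαk x hx
    rw [Submodule.mem_orthogonal] at hx ⊢
    intro u hu
    rw [← inner_conj_symm, inner_archSmoothing_left hτu hτ hαt.continuous hαt.hasCompactSupport, inner_conj_symm]
    -- `mulStar α = α(·⁻¹)` is again a real `Ad K_∞`-invariant test function
    have e1 : mulStar (fun y => (α y : ℂ)) = fun y => ((α y⁻¹ : ℝ) : ℂ) := by
      funext y; simp [mulStar]
    rw [e1]
    refine hx _ (hDα (fun y => α y⁻¹) hαt.comp_inv (fun k hk y => ?_) u hu)
    rw [mul_inv_rev, mul_inv_rev, inv_inv, ← mul_assoc, hαk k hk]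
  -- if `z ≠ 0`, Harish-Chandra's construction in `Dᗮ` produces a `K_∞`-finite Gårding `e ∈ Dᗮ ∩ D`, absurd
  by_contra hz0
  obtain ⟨e, he, he0, heM, hfin⟩ := exists_kFinite_mem_archGardingSpace_ne_zero_of_mem hτ
    (Submodule.isClosed_orthogonal D) hMK hMα hz0 hzD
  have heD : e ∈ D := Submodule.subset_span ⟨he, hfin⟩
  exact he0 (inner_self_eq_zero.1 (Submodule.inner_right_of_mem_orthogonal heD heM))

end Density

/-! ### 4. A non-zero Whittaker functional does not vanish on the `K_∞`-finite Gårding vectors -/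

section Whittaker

variable {hcpt : isCompact_glFiniteIntegralLevel n K}
  {E : Type*} [NormedAddCommGroup E] [InnerProductSpace ℂ E] [CompleteSpace E]
  {τ : ContRepresentation ℂ (AutomorphyDatum.gl n K hcpt).arch.carrier E}
  {hτ : τ.IsStronglyContinuous} {ℓ : archGardingSpace hcpt τ →ₗ[ℂ] ℂ}

/-- **A non-zero continuous `ψ_∞`-Whittaker functional of a unitary representation takes a non-zero value
on some `K_∞`-finite Gårding vector** (Jacquet–Langlands (1970), §5: the Whittaker model on `K_∞`-finite
vectors; Knapp (1986), Ch. VIII §2). [cite: JacquetLanglands1970, §5 (Thm. 5.13)] -/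
theorem exists_kFinite_apply_ne_zero (hℓ : IsArchContWhittakerFunctional hcpt τ hτ ℓ) (hτu : τ.IsUnitary)
    (hne : ℓ ≠ 0) :
    ∃ e : archGardingSpace hcpt τ, ℓ e ≠ 0 ∧
      FiniteDimensional ℂ (Submodule.span ℂ (Set.range fun κ : (AutomorphyDatum.gl n K hcpt).arch.maximalCompact =>
        τ (toArch hcpt (κ : GL (Fin n) (mixedSpace K))) (e : E))) := by
  by_contra hall
  push Not at hall
  -- every Riesz vector of an `Ad K_∞`-invariant real test function vanishes
  have hξ : ∀ α : GL (Fin n) (mixedSpace K) → ℝ, IsArchTestFunction n K (fun x => (α x : ℂ)) →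
      (∀ k ∈ Kinf n K, ∀ x, α (k * x * k⁻¹) = α x) → whittakerRieszVector hcpt τ hτ ℓ (fun x => (α x : ℂ)) = 0 := by
    intro α hαt hαk
    refine eq_zero_of_forall_inner_kFinite_eq_zero hτ hτu fun e he hfin => ?_
    rw [inner_whittakerRieszVector hℓ hτu hαt]
    have hαk' : ∀ k ∈ Kinf n K, ∀ y, (α (k * y * k⁻¹) : ℂ) = α y := fun k hk y => by rw [hαk k hk y]
    by_contra hne'
    exact hall ⟨_, archSmoothing_mem_archGardingSpace hαt e⟩ hne'
      (finiteDimensional_span_archSmoothing_of_adInvariant hτ hαt.continuous hαt.hasCompactSupport hαk' hfin)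
  -- hence `ℓ(τ(α) v) = 0` for all `v`
  have hzero : ∀ α : GL (Fin n) (mixedSpace K) → ℝ, (hαt : IsArchTestFunction n K (fun x => (α x : ℂ))) →
      (∀ k ∈ Kinf n K, ∀ x, α (k * x * k⁻¹) = α x) → ∀ v : E,
        ℓ ⟨archSmoothing hcpt τ (fun x => (α x : ℂ)) v, archSmoothing_mem_archGardingSpace hαt v⟩ = 0 := by
    intro α hαt hαk v
    rw [← inner_whittakerRieszVector hℓ hτu hαt, hξ α hαt hαk, inner_zero_left]
  -- along an `Ad K_∞`-invariant Dirac sequence `ℓ(τ(β_m) τ(ψ) e) → ℓ(τ(ψ) e)`, so `ℓ` kills the generators of `𝒢`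
  obtain ⟨β, hβ, hβk, -⟩ := exists_adInvariant_isDiracSeq (n := n) (K := K)
  have hgen : ∀ (ψ : GL (Fin n) (mixedSpace K) → ℂ) (hψ : IsArchTestFunction n K ψ) (e : E),
      ℓ ⟨archSmoothing hcpt τ ψ e, archSmoothing_mem_archGardingSpace hψ e⟩ = 0 := by
    intro ψ hψ e
    have h := tendsto_apply_archSmoothing_archSmoothing hℓ hτu hψ e hβ
    have h0 : (fun m => ℓ ⟨archSmoothing hcpt τ (fun x => ((β m x : ℝ) : ℂ)) (archSmoothing hcpt τ ψ e),
        archSmoothing_mem_archGardingSpace (hβ.test m) _⟩) = fun _ => 0 := by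
      funext m
      exact hzero (β m) (hβ.test m) (hβk m) _
    rw [h0] at h
    exact tendsto_nhds_unique h tendsto_const_nhds
  refine hne (LinearMap.ext fun v => ?_)
  obtain ⟨m, α, e, hα, hv⟩ := exists_sum_eq_of_mem_archGardingSpace v.2
  have hv' : v = ∑ i, ⟨archSmoothing hcpt τ (α i) (e i), archSmoothing_mem_archGardingSpace (hα i) (e i)⟩ :=
    Subtype.ext (by rw [hv, Submodule.coe_sum])
  rw [hv', _root_.map_sum, LinearMap.zero_apply]
  exact Finset.sum_eq_zero fun i _ => hgen (α i) (hα i) (e i)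

end Whittaker

end Literature.NumberTheory.Automorphic
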